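import Summits.BirchSwinnertonDyer.BirchSwinnertonDyer.Theorems.ManinLocalTwoThreeManinPrimeToThreeAtNineCoreByLevel
import Summits.BirchSwinnertonDyer.BirchSwinnertonDyer.Theorems.ManinLocalTwoThreeSemistableTwistTameAtThree
import Summits.BirchSwinnertonDyer.BirchSwinnertonDyer.Theorems.ManinLocalTwoThreeManinPrimeToAdditiveFiveLeAcrossIsogenyOfStrongIsUnstarred
import Summits.BirchSwinnertonDyer.BirchSwinnertonDyer.Theorems.EdixhovenFibreFiveSevenMemberManinUnitFiveSevenGlue
import Literature.NumberTheory.EllipticCurves.IsogenyQuadraticTwistProofs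
import Literature.NumberTheory.EllipticCurves.IsogenyConductorModularityProofs
import HarnessLib

/-!
# At `3`: Kodaira type NOT `Iₙ*` ⟹ the ternary twist is ADDITIVE and the curve is POTENTIALLY SUPERSINGULAR — the C3 core is EXACTLY
# «type II, III, IV, IV*, III*, II* at 3», its two other binders being consequences
# (route `ManinLocalTwoThree`, crux C3 `ManinPrimeToThreeAtNine` stmt-BirchSwinnertonDyer-22968; cell bsd-f2-manin, p2 gen 15)

Closing the circle of this seat's gen-15 local laws at `3`.  For a globally minimal `W/ℚ` with `9 ∣ N(W)` whose Kodaira type at `3` is not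
`Iₙ*` (`n ≥ 0`):
* `9 ∥ N` (types `III/3`, `III*/9`): the `χ₋₃`-twist is NOT semistable — a global minimal model `C` of `W ⊗ (−3)` has
  `ord₃ Δ_min(C) ≡ ord₃ Δ_min(W) + 6 ≡ 9, 3 (mod 12)` (`padicValInt_minimalDiscriminantInt_twist_pStar_eq`), so `C` is not good, and
  `ord₃ j(C) = ord₃ j(W) ≥ 0` (no `Iₙ*`: `padicValRat_j_nonneg_of_forall_ne_Istar`), so `C` is not multiplicative — the `p = 3` twin of the
  C5 lane's `twist_pStar_not_semistable_of_padicValRat_j_nonneg_of_ne_six` (which needs `p ≥ 5` only for Tate's tame table, replaced here by the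
  tree's `9 ∥ N` classification `nine_dvd_conductorNorm_classification`);
* `27 ∣ N`: every quadratic twist is additive (`hasAdditiveReductionAt_quadraticTwist_placeOf_three_of_twentyseven_dvd`, p707513).
Hence `hasAdditiveReductionAt_quadraticTwist_negThree_of_forall_ne_Istar` (binder (c) from the Kodaira binder) and, by the Tate-form law
`isSemistableAt_quadraticTwist_negThree_of_one_le_valuation_j_of_hasAdditiveReductionAt` (p706475), `valuation_j_lt_one_of_forall_ne_Istar`:
**an additive fibre at `3` of type `II, III, IV, IV*, III*` or `II*` has `|j|₃ < 1`** (`j = 0 ∨ ord₃ j > 0`; Serre–Tate: semistability defect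
`> 2` forces `j̃ = 0 = 1728` in characteristic `3`).  So the C3 core of `maninPrimeToThreeAtNine_of_core` is cut out by the Kodaira condition
ALONE (`coreBinders_of_forall_ne_Istar`); equivalently at `3`: `Iₙ*` ⟺ `W ⊗ (−3)` semistable ⟺ (additive and) NOT potentially supersingular
… the last only for `n ≥ 1` or ordinary `I₀*` (`istar_iff_twist_semistable`).
HONEST FRAMING: local structure theorems; nothing about BSD, Manin's conjecture or C3 is proved.  No definitions, no named facts, no sorry.
[cite: SilvermanATAEC1994, IV.9.4 Table 4.1, IV.10.2, IV.11.1 (p = 3)] [cite: SilvermanAEC2009, VII.5 Prop. 5.1 and X.5 Cor. 5.4.1] [cite: SerreTate1968, §2 Cor. 2]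
-/

set_option autoImplicit false
-- lint-debt: the directory name repeats the summit name (sibling precedent `ManinLocalTwoThreeSemistableTwistTameAtThree.lean`)
set_option linter.dupNamespace false

noncomputable section

open scoped Classical NumberField
open WeierstrassCurve IsDedekindDomain IsDedekindDomain.HeightOneSpectrum Rat.HeightOneSpectrum NumberField
  Literature.NumberTheory.EllipticCurves Literature.NumberTheory.EllipticCurves.ModularForms
  Literature.NumberTheory.EllipticCurves.Rank1Residual
  Literature.NumberTheory.DiophantineGeometry
  Summit.BirchSwinnertonDyer.Rank1Residual
  Summit.BirchSwinnertonDyer.Rank1Residual.ManinAdditive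
  Summit.BirchSwinnertonDyer.Rank1Residual.Additive

namespace Summit.BirchSwinnertonDyer.BirchSwinnertonDyer.Theorems.ManinLocalTwoThree

/-! ## §1 `9 ∥ N`, no `Iₙ*`: the `χ₋₃`-twist is not semistable -/

/-- **At `9 ∥ N` with Kodaira type not `Iₙ*` (i.e. `III` or `III*`), `ord₃ j(W) ≥ 0` and `ord₃ Δ_min(W) ∈ {3, 9}`.**
[cite: SilvermanATAEC1994, IV.9.4 Table 4.1 and IV.11.1] -/
theorem padicValRat_j_nonneg_and_padicValInt_of_nine_dvd_of_forall_ne_Istar (W : WeierstrassCurve ℚ) [W.IsElliptic] [W.IsGloballyMinimal]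
    (h9 : 3 ^ 2 ∣ W.conductorNorm ℤ) (h27 : ¬ 3 ^ 3 ∣ W.conductorNorm ℤ) (hI : ∀ n : ℕ, W.kodairaSymbolAt (placeOf 3) ≠ .Istar n) :
    0 ≤ padicValRat 3 W.j ∧ (padicValInt 3 W.minimalDiscriminantInt = 3 ∨ padicValInt 3 W.minimalDiscriminantInt = 9) := by
  have hadd : Addv W 3 := not_good_and_not_mult_of_sq_dvd_conductorNorm W h9
  refine ⟨?_, ?_⟩
  · refine MemberManinUnitFiveSevenGlue.padicValRat_j_nonneg_of_forall_ne_Istar W (p := 3) (by decide) hadd fun v n hv hK ↦ ?_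
    have hvv : v = placeOf 3 := (primesEquiv (R := ℤ)).injective
      (Subtype.ext (hv.trans (congrArg Subtype.val ((primesEquiv (R := ℤ)).apply_symm_apply ⟨3, Nat.prime_three⟩)).symm))
    subst hvv
    exact hI n hK
  · rcases nine_dvd_conductorNorm_classification W h9 h27 with ⟨-, h⟩ | ⟨hK, -⟩ | ⟨-, h⟩ | ⟨n, hK, -, -⟩
    · exact Or.inl h
    · exact absurd hK (hI 0)
    · exact Or.inr h
    · exact absurd hK (hI (n + 1))

/-- **At `9 ∥ N` with Kodaira type not `Iₙ*`, the twist `W ⊗ ℚ(√−3)` is NOT semistable at `3`**: a global minimal model `C` of the twist has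
`ord₃ Δ_min(C) ≡ ord₃ Δ_min(W) + 6 ∈ {9, 15} (mod 12)`, not `0` (not good), and `ord₃ j(C) = ord₃ j(W) ≥ 0` (not multiplicative).
[cite: SilvermanATAEC1994, IV.9.4 Table 4.1] [cite: SilvermanAEC2009, III.1 Table 3.1, VII.5 Prop. 5.1] -/
theorem not_isSemistableAt_quadraticTwist_negThree_of_nine_dvd_of_forall_ne_Istar (W : WeierstrassCurve ℚ) [W.IsElliptic] [W.IsGloballyMinimal]
    (h9 : 3 ^ 2 ∣ W.conductorNorm ℤ) (h27 : ¬ 3 ^ 3 ∣ W.conductorNorm ℤ) (hI : ∀ n : ℕ, W.kodairaSymbolAt (placeOf 3) ≠ .Istar n) :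
    ¬ ((haveI := W.isElliptic_quadraticTwist (show ((-3 : ℤ) : ℚ) ≠ 0 by norm_num);
        (W.quadraticTwist ((-3 : ℤ) : ℚ)).HasGoodReductionAt (placeOf 3)) ∨
      (W.quadraticTwist ((-3 : ℤ) : ℚ)).HasMultiplicativeReductionAt (placeOf 3)) := by
  obtain ⟨hj, hΔ⟩ := padicValRat_j_nonneg_and_padicValInt_of_nine_dvd_of_forall_ne_Istar W h9 h27 hI
  have hcast : ((-3 : ℤ) : ℚ) = (-1 : ℚ) ^ ((3 : ℕ) / 2) * ((3 : ℕ) : ℚ) := by norm_num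
  have hd0 : ((-1 : ℚ) ^ ((3 : ℕ) / 2) * ((3 : ℕ) : ℚ)) ≠ 0 := by norm_num
  set T : WeierstrassCurve ℚ := W.quadraticTwist ((-1 : ℚ) ^ ((3 : ℕ) / 2) * ((3 : ℕ) : ℚ)) with hT
  haveI hTe : T.IsElliptic := W.isElliptic_quadraticTwist hd0
  obtain ⟨u, hCmin⟩ := hasGlobalMinimalModel_rat_holds T
  set C : WeierstrassCurve ℚ := u • T with hCdef
  haveI : C.IsGloballyMinimal := hCmin
  have hvC : (padicValInt 3 C.minimalDiscriminantInt : ℤ) =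
      padicValInt 3 W.minimalDiscriminantInt + 6 - 12 * padicValRat 3 (u.u : ℚ) :=
    padicValInt_minimalDiscriminantInt_twist_pStar_eq 3 W C u (by rw [hCdef])
  obtain ⟨m, hm⟩ : ∃ m : ℤ, padicValRat 3 (u.u : ℚ) = m := ⟨_, rfl⟩
  rw [hm] at hvC
  have hjC : 0 ≤ padicValRat 3 C.j := by
    rw [j_eq_of_smul_quadraticTwist_eq hd0 u hCdef.symm]; exact hj
  have hngood : ¬ Good C 3 := by
    intro hgood
    have h0 : padicValInt 3 C.minimalDiscriminantInt = 0 :=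
      padicValInt.eq_zero_of_not_dvd (EisensteinPrimes.not_dvd_disc_of_good C 3 hgood)
    rw [h0] at hvC
    rcases hΔ with h | h <;> rw [h] at hvC <;> omega
  have hnmult : ¬ Mult C 3 := fun hmult ↦ not_lt.mpr hjC (EisensteinPrimes.padicValRat_j_neg_of_mult C 3 hmult)
  have hsq' : 3 ^ 2 ∣ C.conductorNorm ℤ := sq_dvd_conductorNorm_of_addv' C ⟨hngood, hnmult⟩
  have hsq : 3 ^ 2 ∣ T.conductorNorm ℤ := by rwa [hCdef, conductorNorm_smul] at hsq'
  obtain ⟨hng, hnm⟩ := not_good_and_not_mult_of_sq_dvd_conductorNorm T hsq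
  rw [hcast]
  rintro (hg | hmu)
  · exact hng ((T.hasGoodReductionAtPrime_iff_hasGoodReductionAt_holds ⟨3, Nat.prime_three⟩).mpr hg)
  · exact hnm ((T.hasMultiplicativeReductionAtPrime_iff_hasMultiplicativeReductionAt_holds ⟨3, Nat.prime_three⟩).mpr hmu)

/-! ## §2 `9 ∣ N`, no `Iₙ*`: the ternary twist is additive and the curve is potentially supersingular -/

/-- **Kodaira binder ⟹ twist binder.**  For a globally minimal `W` with `9 ∣ N(W)` whose Kodaira type at `3` is not `Iₙ*`, the twist
`W ⊗ ℚ(√−3)` is ADDITIVE at `3` (`9 ∥ N`: §1; `27 ∣ N`: p707513). [cite: SilvermanATAEC1994, IV.9.4 Table 4.1, IV.10.2, IV.11.1 (p = 3)] -/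
theorem hasAdditiveReductionAt_quadraticTwist_negThree_of_forall_ne_Istar (W : WeierstrassCurve ℚ) [W.IsElliptic] [W.IsGloballyMinimal]
    (h9 : 3 ^ 2 ∣ W.conductorNorm ℤ) (hI : ∀ n : ℕ, W.kodairaSymbolAt (placeOf 3) ≠ .Istar n) :
    (haveI := W.isElliptic_quadraticTwist (show ((-3 : ℤ) : ℚ) ≠ 0 by norm_num);
      (W.quadraticTwist ((-3 : ℤ) : ℚ)).HasAdditiveReductionAt (placeOf 3)) := by
  have hd0 : ((-3 : ℤ) : ℚ) ≠ 0 := by norm_num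
  haveI := W.isElliptic_quadraticTwist hd0
  by_cases h27 : 3 ^ 3 ∣ W.conductorNorm ℤ
  · exact hasAdditiveReductionAt_quadraticTwist_placeOf_three_of_twentyseven_dvd W h27 hd0
  · rcases hasGoodReductionAt_or_hasMultiplicativeReductionAt_or_hasAdditiveReductionAt (placeOf 3) (W.quadraticTwist ((-3 : ℤ) : ℚ)) with
      hg | hm | ha
    · exact absurd (Or.inl hg) (not_isSemistableAt_quadraticTwist_negThree_of_nine_dvd_of_forall_ne_Istar W h9 h27 hI)
    · exact absurd (Or.inr hm) (not_isSemistableAt_quadraticTwist_negThree_of_nine_dvd_of_forall_ne_Istar W h9 h27 hI)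
    · exact ha

/-- **Kodaira binder ⟹ potentially supersingular.**  For a globally minimal `W` with `9 ∣ N(W)` whose Kodaira type at `3` is not `Iₙ*`:
`|j(W)|₃ < 1` — an additive fibre of type `II, III, IV, IV*, III*, II*` at `3` has `j ≡ 0 (mod 3)` or `j = 0`.
[cite: SilvermanAEC2009, VII.5 Prop. 5.1 and X.5 Cor. 5.4.1] [cite: SerreTate1968, §2 Cor. 2] -/
theorem valuation_j_lt_one_of_forall_ne_Istar (W : WeierstrassCurve ℚ) [W.IsElliptic] [W.IsGloballyMinimal]
    (h9 : 3 ^ 2 ∣ W.conductorNorm ℤ) (hI : ∀ n : ℕ, W.kodairaSymbolAt (placeOf 3) ≠ .Istar n) :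
    (placeOf 3).valuation ℚ W.j < 1 := by
  haveI : PerfectField (IsLocalRing.ResidueField ((placeOf 3).adicCompletionIntegers ℚ)) := PerfectField.ofFinite
  have hd0 : ((-3 : ℤ) : ℚ) ≠ 0 := by norm_num
  haveI := W.isElliptic_quadraticTwist hd0
  have hgen : natGenerator (placeOf 3) = 3 := congrArg Subtype.val ((primesEquiv (R := ℤ)).apply_symm_apply ⟨3, Nat.prime_three⟩)
  have hadd : W.HasAdditiveReductionAt (placeOf 3) := by
    have hfac : (W.conductorNorm ℤ).factorization 3 = W.conductorExponent (placeOf 3) :=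
      factorization_conductorNorm_primesEquiv_symm W ⟨3, Nat.prime_three⟩
    refine (two_le_conductorExponent_iff_holds (placeOf 3) W).mp ?_
    rw [← hfac]
    exact (Nat.prime_three.pow_dvd_iff_le_factorization (W.conductorNorm_pos_holds).ne').mp h9
  have htw := hasAdditiveReductionAt_quadraticTwist_negThree_of_forall_ne_Istar W h9 hI
  by_contra hj
  rcases isSemistableAt_quadraticTwist_negThree_of_one_le_valuation_j_of_hasAdditiveReductionAt (placeOf 3) hgen W (not_lt.mp hj) hadd with
    hg | hm
  · exact htw.not_hasGoodReductionAt hg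
  · exact htw.not_hasMultiplicativeReductionAt hm

/-- `padicValRat` currency: type not `Iₙ*` at `3`, `9 ∣ N(W)` ⟹ `j(W) = 0 ∨ ord₃ j(W) > 0`. [cite: SilvermanATAEC1994, IV.9.4 Table 4.1] -/
theorem j_eq_zero_or_padicValRat_j_pos_of_forall_ne_Istar (W : WeierstrassCurve ℚ) [W.IsElliptic] [W.IsGloballyMinimal]
    (h9 : 3 ^ 2 ∣ W.conductorNorm ℤ) (hI : ∀ n : ℕ, W.kodairaSymbolAt (placeOf 3) ≠ .Istar n) :
    W.j = 0 ∨ 0 < padicValRat 3 W.j :=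
  (valuation_placeOf_three_lt_one_iff W.j).mp (valuation_j_lt_one_of_forall_ne_Istar W h9 hI)

/-- **The C3 core binders from the Kodaira binder alone**: `9 ∣ N(W)`, type not `Iₙ*` at `3` ⟹ `|j|₃ < 1` ∧ `W ⊗ ℚ(√−3)` additive at `3`.
So `maninPrimeToThreeAtNine_of_core` reads: C3 ⟸ C3 on the classes of Kodaira type `II, III, IV, IV*, III*, II*` at `3`, full stop.
[cite: SilvermanATAEC1994, IV.9.4 Table 4.1, IV.11.1 (p = 3)] -/
theorem coreBinders_of_forall_ne_Istar (W : WeierstrassCurve ℚ) [W.IsElliptic] [W.IsGloballyMinimal]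
    (h9 : 3 ^ 2 ∣ W.conductorNorm ℤ) (hI : ∀ n : ℕ, W.kodairaSymbolAt (placeOf 3) ≠ .Istar n) :
    (placeOf 3).valuation ℚ W.j < 1 ∧
      (haveI := W.isElliptic_quadraticTwist (show ((-3 : ℤ) : ℚ) ≠ 0 by norm_num);
        (W.quadraticTwist ((-3 : ℤ) : ℚ)).HasAdditiveReductionAt (placeOf 3)) :=
  ⟨valuation_j_lt_one_of_forall_ne_Istar W h9 hI, hasAdditiveReductionAt_quadraticTwist_negThree_of_forall_ne_Istar W h9 hI⟩

/-! ## §3 The dictionary at `3`: `Iₙ*` ⟺ semistable ternary twist -/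

/-- **At an additive `3` (`9 ∣ N(W)`): the Kodaira type is `Iₙ*` for some `n` iff `W ⊗ ℚ(√−3)` is semistable at `3`.**  (⟹: `I₀*` twists to
good, `Iₙ≥1*` to multiplicative reduction — tree rows; ⟸: §2.) [cite: SilvermanATAEC1994, IV.9.4 Table 4.1 and IV.11.1 (p = 3, table p. 368)] -/
theorem exists_kodairaSymbolAt_eq_Istar_iff_isSemistableAt_quadraticTwist_negThree (W : WeierstrassCurve ℚ) [W.IsElliptic] [W.IsGloballyMinimal]
    (h9 : 3 ^ 2 ∣ W.conductorNorm ℤ) :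
    (∃ n : ℕ, W.kodairaSymbolAt (placeOf 3) = .Istar n) ↔
      ((haveI := W.isElliptic_quadraticTwist (show ((-3 : ℤ) : ℚ) ≠ 0 by norm_num);
        (W.quadraticTwist ((-3 : ℤ) : ℚ)).HasGoodReductionAt (placeOf 3)) ∨
      (W.quadraticTwist ((-3 : ℤ) : ℚ)).HasMultiplicativeReductionAt (placeOf 3)) := by
  haveI : PerfectField (IsLocalRing.ResidueField ((placeOf 3).adicCompletionIntegers ℚ)) := PerfectField.ofFinite
  have hd0 : ((-3 : ℤ) : ℚ) ≠ 0 := by norm_num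
  haveI := W.isElliptic_quadraticTwist hd0
  have hgen : natGenerator (placeOf 3) = 3 := congrArg Subtype.val ((primesEquiv (R := ℤ)).apply_symm_apply ⟨3, Nat.prime_three⟩)
  constructor
  · rintro ⟨n, hK⟩
    have h2 : ringChar (ℤ ⧸ (placeOf 3).asIdeal) ≠ 2 := by rw [ringChar_int_quot_placeOf 3]; decide
    rcases n with _ | n
    · have hπ : (placeOf 3).valuation ℚ ((-3 : ℤ) : ℚ) = WithZero.exp (-1 : ℤ) := by
        have h := valuation_natGenerator_int (placeOf 3)
        rw [hgen] at h
        rw [Int.cast_neg, Valuation.map_neg]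
        exact_mod_cast h
      exact Or.inl (W.hasGoodReductionAt_quadraticTwist_of_kodairaSymbolAt_eq_Istar_zero (placeOf 3) h2 hK hπ)
    · have hm := hasMultiplicativeReductionAt_quadraticTwist_pStar_of_kodairaSymbolAt_eq_Istar_succ (W := W) Nat.prime_three (by decide) hK
      have h3 : (((-1 : ℤ) ^ (3 / 2) * (3 : ℕ) : ℤ) : ℚ) = ((-3 : ℤ) : ℚ) := by norm_num
      rw [h3] at hm
      exact Or.inr hm
  · intro hsemi
    by_contra hI
    push Not at hI
    have ha := hasAdditiveReductionAt_quadraticTwist_negThree_of_forall_ne_Istar W h9 hI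
    rcases hsemi with hg | hm
    · exact ha.not_hasGoodReductionAt hg
    · exact ha.not_hasMultiplicativeReductionAt hm

/-! ## §4 The core is ISOGENY-INVARIANT modulo modularity (answer in substance to T-p1-g13-2) -/

/-- **The C3 core of a class is cut out by the twist binder alone**: for a globally minimal `W` with `9 ∣ N(W)`, the three binders
(`|j|₃ < 1`, type not `Iₙ*`, `W ⊗ ℚ(√−3)` additive at `3`) hold iff the last one does (`9 ∥ N`/`27 ∣ N`: §2 and the dictionary §3;
`|j|₃ < 1` from the Tate-form law p706475).  [cite: SilvermanATAEC1994, IV.9.4 Table 4.1 and IV.11.1 (p = 3)] -/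
theorem coreBinders_iff_hasAdditiveReductionAt_quadraticTwist_negThree (W : WeierstrassCurve ℚ) [W.IsElliptic] [W.IsGloballyMinimal]
    (h9 : 3 ^ 2 ∣ W.conductorNorm ℤ) :
    ((placeOf 3).valuation ℚ W.j < 1 ∧ (∀ n : ℕ, W.kodairaSymbolAt (placeOf 3) ≠ .Istar n) ∧
      (haveI := W.isElliptic_quadraticTwist (show ((-3 : ℤ) : ℚ) ≠ 0 by norm_num);
        (W.quadraticTwist ((-3 : ℤ) : ℚ)).HasAdditiveReductionAt (placeOf 3))) ↔
    (haveI := W.isElliptic_quadraticTwist (show ((-3 : ℤ) : ℚ) ≠ 0 by norm_num);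
      (W.quadraticTwist ((-3 : ℤ) : ℚ)).HasAdditiveReductionAt (placeOf 3)) := by
  haveI := W.isElliptic_quadraticTwist (show ((-3 : ℤ) : ℚ) ≠ 0 by norm_num)
  refine ⟨fun h ↦ h.2.2, fun htw ↦ ?_⟩
  have hI : ∀ n : ℕ, W.kodairaSymbolAt (placeOf 3) ≠ .Istar n := by
    intro n hK
    rcases (exists_kodairaSymbolAt_eq_Istar_iff_isSemistableAt_quadraticTwist_negThree W h9).mp ⟨n, hK⟩ with hg | hm
    · exact htw.not_hasGoodReductionAt hg
    · exact htw.not_hasMultiplicativeReductionAt hm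
  exact ⟨valuation_j_lt_one_of_forall_ne_Istar W h9 hI, hI, htw⟩

/-- **The twist binder transports along isogenies, modulo modularity**: for isogenous elliptic `W ∼ W'` over `ℚ`, `W ⊗ ℚ(√−3)` is additive at
`3` iff `W' ⊗ ℚ(√−3)` is (the twists are isogenous, `IsIsogenous.quadraticTwist`; isogenous curves have equal conductors given modularity,
`conductorNorm_eq_of_isIsogenous_of_modularity`; additivity is `9 ∣ N`).  With `coreBinders_iff_hasAdditiveReductionAt_quadraticTwist_negThree`:
the C3 CORE is an invariant of the isogeny class — no «potential supersingularity is an isogeny invariant» fact is needed (asked as T-p1-g13-2).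
[cite: DiamondShurman2005, Thm. 8.8.1] [cite: CremonaAlgorithms1997, §3.9] [cite: SilvermanATAEC1994, IV.10.2] -/
theorem hasAdditiveReductionAt_quadraticTwist_negThree_iff_of_isIsogenous (hnf : exists_isNewformOf)
    {W W' : WeierstrassCurve ℚ} [W.IsElliptic] [W'.IsElliptic] (hiso : IsIsogenous W W') :
    (haveI := W.isElliptic_quadraticTwist (show ((-3 : ℤ) : ℚ) ≠ 0 by norm_num);
      (W.quadraticTwist ((-3 : ℤ) : ℚ)).HasAdditiveReductionAt (placeOf 3)) ↔
    (haveI := W'.isElliptic_quadraticTwist (show ((-3 : ℤ) : ℚ) ≠ 0 by norm_num);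
      (W'.quadraticTwist ((-3 : ℤ) : ℚ)).HasAdditiveReductionAt (placeOf 3)) := by
  haveI : PerfectField (IsLocalRing.ResidueField ((placeOf 3).adicCompletionIntegers ℚ)) := PerfectField.ofFinite
  have hd0 : ((-3 : ℤ) : ℚ) ≠ 0 := by norm_num
  haveI := W.isElliptic_quadraticTwist hd0
  haveI := W'.isElliptic_quadraticTwist hd0
  have hmod : nonempty_modularParametrizationData := nonempty_modularParametrizationData_iff_exists_isNewformOf_unconditional.mpr hnf
  have hN : (W.quadraticTwist ((-3 : ℤ) : ℚ)).conductorNorm ℤ = (W'.quadraticTwist ((-3 : ℤ) : ℚ)).conductorNorm ℤ :=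
    conductorNorm_eq_of_isIsogenous_of_modularity hmod _ _ (hiso.quadraticTwist hd0)
  have hf : (W.quadraticTwist ((-3 : ℤ) : ℚ)).conductorExponent (placeOf 3) = (W'.quadraticTwist ((-3 : ℤ) : ℚ)).conductorExponent (placeOf 3) := by
    have h1 : ((W.quadraticTwist ((-3 : ℤ) : ℚ)).conductorNorm ℤ).factorization 3 = (W.quadraticTwist ((-3 : ℤ) : ℚ)).conductorExponent (placeOf 3) :=
      factorization_conductorNorm_primesEquiv_symm _ ⟨3, Nat.prime_three⟩
    have h2 : ((W'.quadraticTwist ((-3 : ℤ) : ℚ)).conductorNorm ℤ).factorization 3 = (W'.quadraticTwist ((-3 : ℤ) : ℚ)).conductorExponent (placeOf 3) :=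
      factorization_conductorNorm_primesEquiv_symm _ ⟨3, Nat.prime_three⟩
    rw [← h1, ← h2, hN]
  rw [← two_le_conductorExponent_iff_holds (placeOf 3) (W.quadraticTwist ((-3 : ℤ) : ℚ)),
    ← two_le_conductorExponent_iff_holds (placeOf 3) (W'.quadraticTwist ((-3 : ℤ) : ℚ)), hf]

/-- **The C3 core is isogeny-invariant, modulo modularity**: for isogenous globally minimal `W ∼ W'` with `9 ∣ N(W)` (`= N(W')`), the three core
binders hold at `W` iff they hold at `W'`. [cite: DiamondShurman2005, Thm. 8.8.1] [cite: SilvermanATAEC1994, IV.9.4 Table 4.1 and IV.11.1 (p = 3)] -/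
theorem coreBinders_iff_of_isIsogenous (hnf : exists_isNewformOf)
    {W W' : WeierstrassCurve ℚ} [W.IsElliptic] [W.IsGloballyMinimal] [W'.IsElliptic] [W'.IsGloballyMinimal] (hiso : IsIsogenous W W')
    (h9 : 3 ^ 2 ∣ W.conductorNorm ℤ) :
    ((placeOf 3).valuation ℚ W.j < 1 ∧ (∀ n : ℕ, W.kodairaSymbolAt (placeOf 3) ≠ .Istar n) ∧
      (haveI := W.isElliptic_quadraticTwist (show ((-3 : ℤ) : ℚ) ≠ 0 by norm_num);
        (W.quadraticTwist ((-3 : ℤ) : ℚ)).HasAdditiveReductionAt (placeOf 3))) ↔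
    ((placeOf 3).valuation ℚ W'.j < 1 ∧ (∀ n : ℕ, W'.kodairaSymbolAt (placeOf 3) ≠ .Istar n) ∧
      (haveI := W'.isElliptic_quadraticTwist (show ((-3 : ℤ) : ℚ) ≠ 0 by norm_num);
        (W'.quadraticTwist ((-3 : ℤ) : ℚ)).HasAdditiveReductionAt (placeOf 3))) := by
  have hmod : nonempty_modularParametrizationData := nonempty_modularParametrizationData_iff_exists_isNewformOf_unconditional.mpr hnf
  have h9' : 3 ^ 2 ∣ W'.conductorNorm ℤ := by rwa [← conductorNorm_eq_of_isIsogenous_of_modularity hmod W W' hiso]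
  rw [coreBinders_iff_hasAdditiveReductionAt_quadraticTwist_negThree W h9, coreBinders_iff_hasAdditiveReductionAt_quadraticTwist_negThree W' h9',
    hasAdditiveReductionAt_quadraticTwist_negThree_iff_of_isIsogenous hnf hiso]

end Summit.BirchSwinnertonDyer.BirchSwinnertonDyer.Theorems.ManinLocalTwoThree

end
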